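import Summits.BirchSwinnertonDyer.BirchSwinnertonDyer.Theorems.Rank2ObservatoryRank3ModTwoImage
import Summits.BirchSwinnertonDyer.BirchSwinnertonDyer.Theorems.Rank2ObservatoryRank3ModThreeImage
import Summits.BirchSwinnertonDyer.BirchSwinnertonDyer.Theorems.Rank2ObservatoryRank3ModFiveImageComplete
import Summits.BirchSwinnertonDyer.BirchSwinnertonDyer.Theorems.Rank2ObservatoryRank3ModSevenImage
import Summits.BirchSwinnertonDyer.BirchSwinnertonDyer.Theorems.Rank2ObservatoryRank3ModElevenImage
import Summits.BirchSwinnertonDyer.BirchSwinnertonDyer.Theorems.Rank2ObservatoryRank3ModThirteenImage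
import HarnessLib

/-!
# Rank-2 observatory, rank-3 arm — THE SMALL-PRIME GALOIS IMAGE ATLAS OF THE RANK-3 TABLE:
# for EVERY row and EVERY prime `p ≤ 13`, `ρ̄_{E,p}` onto `GL₂(𝔽_p)` or not is ONE kernel-decided Boolean `ontoIdxB p i`
# (rows 64, 66, 67, 68, 69, 70 joined), and — index-free, for every row and every prime `3 ≤ p ≤ 13` —
# `ρ̄_{E,p}` is onto iff `E[p]` is irreducible, `E` has no CM, (`p = 3 ⇒ Δ` is not a cube) and (`p = 5 ⇒ j ≠ 421632`)

HONEST FRAMING: per-curve certified theorems and census instruments; no claim on BSD in rank ≥ 2.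
Cell `b2b-bsdr2`, unit `b2b-bsdr2-cert-2` (rank-3 arm), gen 63 (KCI row 71); zero-kit; NO new data (a join of landed rows).
`--supports stmt-BirchSwinnertonDyer-16218 --as helper` (no stub closes; the value is a theorem).

WHAT IS CERTIFIED, for every row `r = rank3Table[i]`:
* `Rank3Row.hasSurjectiveModNGaloisRep_iff_ontoIdxB h p hp (h13 : p ≤ 13) : onto p ↔ ontoIdxB p i = true` — the six decided
  censuses behind one predicate: `p = 2`: off row 58's `2`-torsion list and off `c3Sqrt` (row 64); `p = 3`: off the `Ψ₃`-root list
  and off `cubeRt` (row 66); `p = 5`: off `redFive`, off `cmIdx`, `i ≠ 975` (row 67 + its completion); `p = 7, 11, 13`: off `cmIdx`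
  (rows 68–70).  USE: ONE call discharges the binder `W.HasSurjectiveModNGaloisRep p` of any instrument at any `p ≤ 13`:
  `(Rank3Row.hasSurjectiveModNGaloisRep_iff_ontoIdxB h p hp h13).mpr (by decide +kernel)`; and
  `Rank3Row.hasSurjectiveModNGaloisRep_of_allSmallB h (hb : allSmallB i = true) : ∀ p, p.Prime → p ≤ 13 → onto p`.
* `Rank3Row.hasSurjectiveModNGaloisRep_iff_of_mem` — INDEX-FREE CLASSIFICATION for `3 ≤ p ≤ 13`: onto iff `E[p]` irreducible ∧
  no CM ∧ (`p = 3 →` no `c : ℤ` with `Δ = c³`) ∧ (`p = 5 → j ≠ 421632`); each failure mode is realised on the table (rows 60, 48,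
  66, 67).  For `7 ≤ p ≤ 13` this is `Rank3Row.hasSurjectiveModNGaloisRep_iff_not_hasCM_of_le`: onto iff no CM.
  (`p = 2` is row 64's generic `hasSurjectiveModNGaloisRep_two_iff_irreducible_and_not_isSquare`: onto iff `E[2]` irreducible ∧
  `Δ` not a square — CM is no obstruction at `2`.)
* `allSmallOntoRows_count` — `ρ̄_{E,p}` is onto for EVERY prime `p ≤ 13` on exactly `8 325` rows (kernel count of `allSmallB`, two halves).
NOT CLAIMED: images at primes `p > 13` (row 53 treats the semistable rows at every prime); image types beyond "onto / not onto";
table completeness; BSD.  Sources: Serre, Invent. Math. 15 (1972); Mazur, Invent. Math. 44 (1978); Zywina, arXiv:1508.07660 (2015);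
Dokchitser–Dokchitser, Math. Z. 272 (2012) (mod 2) — all through the cited rows' tree theorems.
-/

set_option linter.dupNamespace false
set_option autoImplicit false

namespace Summit.BirchSwinnertonDyer.BirchSwinnertonDyer.Rank2Observatory

open Literature Literature.NumberTheory.EllipticCurves WeierstrassCurve

/-! ## §1 One Boolean for six censuses -/

/-- row `i` is listed as onto at the prime `p` (`p ≤ 13`; for other `p` the value is row 68's CM test and carries no claim).
[folklore] -/
def ontoIdxB (p i : ℕ) : Bool :=
  if p = 2 then (redTwoAt i).isNone && (c3At i).isNone
  else if p = 3 then (redThreeAt i).isNone && (cubeAt i).isNone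
  else if p = 5 then !decide (i ∈ redFive) && !decide (i ∈ cmIdx) && i != 975
  else !decide (i ∈ cmIdx)

/-- the primes `p ≤ 13`. [folklore] -/
theorem eq_of_prime_le_thirteen {p : ℕ} (hp : p.Prime) (h13 : p ≤ 13) :
    p = 2 ∨ p = 3 ∨ p = 5 ∨ p = 7 ∨ p = 11 ∨ p = 13 := by
  have hp2 := hp.two_le
  interval_cases p <;> first | decide | exact absurd hp (by decide)

/-- **EVERY ROW, EVERY PRIME `p ≤ 13`: `ρ̄_{E_r,p}` onto `GL₂(𝔽_p)` iff `ontoIdxB p i`.**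
[cite: Serre1972, §2.4 Prop. 15] [cite: DokchitserDokchitserMathZ2012, Theorem (1)] [cite: Zywina2015, Thm. 1.4] -/
theorem Rank3Row.hasSurjectiveModNGaloisRep_iff_ontoIdxB {i : ℕ} {r : Rank3Row} (h : rank3Table[i]? = some r)
    (p : ℕ) (hp : p.Prime) (h13 : p ≤ 13) : r.curve.HasSurjectiveModNGaloisRep p ↔ ontoIdxB p i = true := by
  obtain rfl | rfl | rfl | rfl | rfl | rfl := eq_of_prime_le_thirteen hp h13
  all_goals
    rw [Nat.cast_ofNat]
    simp only [ontoIdxB, Nat.reduceEqDiff, if_true, if_false, Bool.and_eq_true, Option.isNone_iff_eq_none,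
      Bool.not_eq_true', decide_eq_false_iff_not, bne_iff_ne, ne_eq]
  · exact Rank3Row.hasSurjectiveModNGaloisRep_two_iff_of_getElem? h
  · exact Rank3Row.hasSurjectiveModNGaloisRep_three_iff_of_getElem? h
  · rw [Rank3Row.hasSurjectiveModNGaloisRep_five_iff h]; tauto
  · exact Rank3Row.hasSurjectiveModNGaloisRep_seven_iff_of_getElem? h
  · exact Rank3Row.hasSurjectiveModNGaloisRep_eleven_iff_of_getElem? h
  · exact Rank3Row.hasSurjectiveModNGaloisRep_thirteen_iff_of_getElem? h

/-- row `i` is listed as onto at every prime `p ≤ 13` (at `7`, `11`, `13` the test is the same: off `cmIdx`). [folklore] -/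
def allSmallB (i : ℕ) : Bool := ontoIdxB 2 i && ontoIdxB 3 i && ontoIdxB 5 i && ontoIdxB 7 i

/-- **USE: one kernel Boolean discharges surjectivity at every prime `p ≤ 13`.** [cite: Serre1972, §2.4 Prop. 15] -/
theorem Rank3Row.hasSurjectiveModNGaloisRep_of_allSmallB {i : ℕ} {r : Rank3Row} (h : rank3Table[i]? = some r)
    (hb : allSmallB i = true) (p : ℕ) (hp : p.Prime) (h13 : p ≤ 13) : r.curve.HasSurjectiveModNGaloisRep p := by
  rw [Rank3Row.hasSurjectiveModNGaloisRep_iff_ontoIdxB h p hp h13]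
  simp only [allSmallB, Bool.and_eq_true] at hb
  obtain ⟨⟨⟨h2, h3⟩, h5⟩, h7⟩ := hb
  obtain rfl | rfl | rfl | rfl | rfl | rfl := eq_of_prime_le_thirteen hp h13
  all_goals assumption  -- at `11`, `13` the goal `ontoIdxB _ i = true` is definitionally `h7` (both reduce to the CM test)

section counts
set_option maxHeartbeats 4000000
/-- kernel count, rows `0 … 4743`. [folklore] -/
theorem allSmallOntoRows_count_lo : ((List.range' 0 4744).filter allSmallB).length = 4237 := by decide +kernel
/-- kernel count, rows `4744 … 9486`. [folklore] -/
theorem allSmallOntoRows_count_hi : ((List.range' 4744 4743).filter allSmallB).length = 4088 := by decide +kernel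
end counts

/-- **`ρ̄_{E,p}` is onto `GL₂(𝔽_p)` for EVERY prime `p ≤ 13` on exactly `8 325` of the `9 487` rows** (the two kernel halves; one
pass over `List.range 9487` exceeds the kernel's recursion budget with seven lookups per row). [folklore] -/
theorem allSmallOntoRows_count : ((List.range 9487).filter allSmallB).length = 8325 := by
  rw [show List.range 9487 = List.range' 0 4744 ++ List.range' 4744 4743 by rw [List.range_eq_range', List.range'_append],
    List.filter_append, List.length_append, allSmallOntoRows_count_lo, allSmallOntoRows_count_hi]

/-! ## §2 The index-free classification, `3 ≤ p ≤ 13` -/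

/-- **FOR EVERY ROW AND EVERY PRIME `7 ≤ p ≤ 13`: `ρ̄_{E,p}` onto iff `E` has no CM.** [cite: Serre1972, §2.4 Prop. 15, §4.5] -/
theorem Rank3Row.hasSurjectiveModNGaloisRep_iff_not_hasCM_of_le {r : Rank3Row} (hr : r ∈ rank3Table) (p : ℕ) (hp : p.Prime)
    (h7 : 7 ≤ p) (h13 : p ≤ 13) : r.curve.HasSurjectiveModNGaloisRep p ↔ ¬ r.curve.HasCM := by
  obtain rfl | rfl | rfl | rfl | rfl | rfl := eq_of_prime_le_thirteen hp h13 <;> try omega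
  all_goals rw [Nat.cast_ofNat]
  · exact Rank3Row.hasSurjectiveModNGaloisRep_seven_iff_not_hasCM hr
  · exact Rank3Row.hasSurjectiveModNGaloisRep_eleven_iff_not_hasCM hr
  · exact Rank3Row.hasSurjectiveModNGaloisRep_thirteen_iff_not_hasCM hr

/-- **THE INDEX-FREE CLASSIFICATION, every row of the rank-`3` table, every prime `3 ≤ p ≤ 13`**: `ρ̄_{E,p}` is onto `GL₂(𝔽_p)`
iff `E[p]` is irreducible, `E` has no CM, (`p = 3 ⇒ Δ` is not the cube of an integer) and (`p = 5 ⇒ j(E) ≠ 421632`).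
[cite: Serre1972, §2.4 Prop. 15, §4.5] [cite: Zywina2015, Thm. 1.4] -/
theorem Rank3Row.hasSurjectiveModNGaloisRep_iff_of_mem {r : Rank3Row} (hr : r ∈ rank3Table) (p : ℕ) (hp : p.Prime)
    (h3 : 3 ≤ p) (h13 : p ≤ 13) :
    r.curve.HasSurjectiveModNGaloisRep p ↔
      (haveI : Fact p.Prime := ⟨hp⟩; r.curve.HasIrreducibleModPGaloisRep p) ∧ ¬ r.curve.HasCM ∧
        (p = 3 → ¬ ∃ c : ℤ, r.curve.Δ = (c : ℚ) ^ 3) ∧ (p = 5 → (haveI := isElliptic_of_mem hr; r.curve.j) ≠ 421632) := by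
  haveI := isElliptic_of_mem hr
  obtain ⟨i, h⟩ := List.mem_iff_getElem?.mp hr
  have hcm : ∀ q : ℕ, q.Prime → q ≠ 2 → r.curve.HasSurjectiveModNGaloisRep q → ¬ r.curve.HasCM := fun q hq hq2 hs hc =>
    Rank3Row.not_hasSurjectiveModNGaloisRep_of_mem_cmIdx h ((Rank3Row.hasCM_iff_of_getElem? h).mp hc) q hq hq2 hs
  obtain rfl | rfl | rfl | rfl | rfl | rfl := eq_of_prime_le_thirteen hp h13 <;> try omega
  · -- p = 3
    haveI : Fact (Nat.Prime 3) := ⟨hp⟩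
    have hcm3 := hcm 3 hp (by norm_num)
    have hor := Rank3Row.surjective_three_or hr
    rw [Nat.cast_ofNat] at hcm3 ⊢
    constructor
    · intro hs
      exact ⟨hasIrreducibleModPGaloisRep_three_of_hasSurjectiveModNGaloisRep r.curve hs, hcm3 hs,
        fun _ hc => hc.elim fun c hc => ModThreeImage.not_hasSurjectiveModNGaloisRep_three_of_Δ_eq_cube r.curve hc hs,
        fun h35 => absurd h35 (by norm_num)⟩
    · rintro ⟨hirr, -, hcube, -⟩
      rcases hor with hs | hred | hc
      · exact hs
      · exact absurd hirr hred
      · exact absurd hc (hcube rfl)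
  · -- p = 5
    rw [Nat.cast_ofNat, Rank3Row.hasSurjectiveModNGaloisRep_five_iff_of_mem hr]
    constructor
    · rintro ⟨hirr, hc, hj⟩
      exact ⟨hirr, hc, fun h53 => absurd h53 (by norm_num), fun _ => hj⟩
    · rintro ⟨hirr, hc, -, hj⟩
      exact ⟨hirr, hc, hj rfl⟩
  · -- p = 7
    haveI : Fact (Nat.Prime 7) := ⟨hp⟩
    rw [Nat.cast_ofNat, Rank3Row.hasSurjectiveModNGaloisRep_seven_iff_not_hasCM hr]
    exact ⟨fun hc => ⟨Rank3Row.hasIrreducibleModPGaloisRep_of_mem_mazurPrimes hr 7 (by decide) (by norm_num), hc,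
      fun e => absurd e (by norm_num), fun e => absurd e (by norm_num)⟩, fun hh => hh.2.1⟩
  · -- p = 11
    haveI : Fact (Nat.Prime 11) := ⟨hp⟩
    rw [Nat.cast_ofNat, Rank3Row.hasSurjectiveModNGaloisRep_eleven_iff_not_hasCM hr]
    exact ⟨fun hc => ⟨Rank3Row.hasIrreducibleModPGaloisRep_of_mem_mazurPrimes hr 11 (by decide) (by norm_num), hc,
      fun e => absurd e (by norm_num), fun e => absurd e (by norm_num)⟩, fun hh => hh.2.1⟩
  · -- p = 13
    haveI : Fact (Nat.Prime 13) := ⟨hp⟩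
    rw [Nat.cast_ofNat, Rank3Row.hasSurjectiveModNGaloisRep_thirteen_iff_not_hasCM hr]
    exact ⟨fun hc => ⟨Rank3Row.hasIrreducibleModPGaloisRep_of_mem_mazurPrimes hr 13 (by decide) (by norm_num), hc,
      fun e => absurd e (by norm_num), fun e => absurd e (by norm_num)⟩, fun hh => hh.2.1⟩

/-! ## §3 Sample -/

/-- **`5077a1`** (row `0`): `ρ̄_{E,p}` onto `GL₂(𝔽_p)` for every prime `p ≤ 13`. [cite: Serre1972, §2.4 Prop. 15] -/
theorem hasSurjectiveModNGaloisRep_small_5077a1 {r : Rank3Row} (h : rank3Table[0]? = some r) (p : ℕ) (hp : p.Prime)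
    (h13 : p ≤ 13) : r.curve.HasSurjectiveModNGaloisRep p :=
  Rank3Row.hasSurjectiveModNGaloisRep_of_allSmallB h (by decide +kernel) p hp h13

end Summit.BirchSwinnertonDyer.BirchSwinnertonDyer.Rank2Observatory
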